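import Literature.NumberTheory.DiophantineGeometry.GenEllKummerDifferent
import Mathlib.FieldTheory.SplittingField.Construction
import Mathlib.RingTheory.Polynomial.Cyclotomic.Roots
import Mathlib.FieldTheory.Normal.Basic
import Mathlib.FieldTheory.Galois.Basic
import HarnessLib

/-!
# [GenEll] Prop. 1.7 (i) for the Kummer covering of `ℙ¹ ∖ {0,1,∞}`: construction of the tower

S. Mochizuki, *Arithmetic elliptic curves in general position*, Math. J. Okayama Univ. 52 (2010)
[cite: MochizukiGenEll2010], Prop. 1.7 (i) pp. 9–10 and the proof of Thm. 2.1, pp. 11–12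
("there exists a connected finite étale Galois covering `U_Y → U_X` … ramified at each point of
`E` with ramification index equal to `e`"; for `X = ℙ¹`, `D = [0]+[1]+[∞]` one may take the Fermat
covering `u^e + w^e = 1`, `λ = u^e`). `GenEllKummerDifferent.logdisc_kummer_le` bounds the
log-different of the Galois closure `N = K(ζ_e, x^{1/e}, (1−x)^{1/e})` of that covering over the
field `K` of a point `x ∈ U(K)`, GIVEN the tower `K ⊆ K(ζ) ⊆ K(ζ, u) ⊆ N` as data. This file
CONSTRUCTS the tower for every splitting field `N` of `(T^e − 1)(T^e − x)(T^e − (1 − x))` over `K`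
and concludes, unconditionally:

* `exists_isPrimitiveRoot`, `exists_pow_eq`, `adjoin_eq_top_of_roots` — in such `N`: a primitive
  `e`-th root of unity `ζ`, roots `u^e = x`, `w^e = 1 − x`, and `N = K(ζ, u, w)`;
* `isGalois_of_isSplittingField_kummer` — `N/K` is Galois;
* `finrank_le_of_isSplittingField_kummer` — `[N:K] ≤ e³`;
* `logdisc_le_of_isSplittingField_kummer` — **Prop. 1.7 (i), right inequality, for the Kummer
  covering**: `logdisc N ≤ log-diff(x) + log-cond_C(x) + log e + log [N:K] + log [N:K]!`, for any
  point `x ∈ U(K)` (tree `NFPoint`, `InU`) and any splitting field `N`;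
  `NFPoint.logDiff_le_of_kummer` — hence for every point `(u, w)` of the Fermat curve
  `u^e + w^e = 1` lying over `x = u^e`, presented over `K(u, w)`:
  `log-diff(u, w) ≤ log-diff(x) + log-cond_C(x) + (4 log e + log (e³)!)`.

This closes the different input of STEP 1 of the proof of [GenEll] Thm. 2.1 for `ℙ¹`
(route item GenEllTwo of `Summit.ABC.ABC.Theses.IUTThetaPilot`): `log-diff_Y ≲ log-diff_X +
log-cond_D` on the Fermat covering `Y → X = ℙ¹`, with an explicit constant depending only on `e`
on points of every degree. Theorems only; no definitions, no named facts.
-/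

noncomputable section

open NumberField IsDedekindDomain Polynomial IntermediateField

namespace Literature.NumberTheory.DiophantineGeometry.GenEll

section SplittingField

variable {K : Type*} [Field K] (N : Type*) [Field N] [Algebra K N] {e : ℕ} (x : K)

/-- In a splitting field of `(T^e − 1)(T^e − x)(T^e − (1−x))` the three factors split. [folklore] -/
private theorem splits_factors (he : 0 < e)
    [IsSplittingField K N ((X ^ e - 1) * ((X ^ e - C x) * (X ^ e - C (1 - x))))] :
    Splits (X ^ e - 1 : N[X]) ∧ Splits (X ^ e - C (algebraMap K N x)) ∧
      Splits (X ^ e - C (algebraMap K N (1 - x))) := by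
  have hs := IsSplittingField.splits N ((X ^ e - 1) * ((X ^ e - C x) * (X ^ e - C (1 - x))) : K[X])
  simp only [Polynomial.map_mul, Polynomial.map_sub, Polynomial.map_pow, map_X, Polynomial.map_one,
    map_C] at hs
  have h1 : (X ^ e - 1 : N[X]) ≠ 0 := by
    rw [← C_1]; exact X_pow_sub_C_ne_zero he 1
  have h2 : (X ^ e - C (algebraMap K N x) : N[X]) ≠ 0 := X_pow_sub_C_ne_zero he _
  have h3 : (X ^ e - C (algebraMap K N (1 - x)) : N[X]) ≠ 0 := X_pow_sub_C_ne_zero he _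
  have h23 : (X ^ e - C (algebraMap K N x)) * (X ^ e - C (algebraMap K N (1 - x))) ≠ 0 :=
    mul_ne_zero h2 h3
  have hne : (X ^ e - 1 : N[X]) * ((X ^ e - C (algebraMap K N x)) *
      (X ^ e - C (algebraMap K N (1 - x)))) ≠ 0 := mul_ne_zero h1 h23
  refine ⟨hs.of_dvd hne (dvd_mul_right _ _), hs.of_dvd hne ?_, hs.of_dvd hne ?_⟩
  · exact (dvd_mul_right _ _).trans (dvd_mul_left _ _)
  · exact (dvd_mul_left _ _).trans (dvd_mul_left _ _)

/-- A splitting field of `(T^e − 1)(T^e − x)(T^e − (1−x))`, `e ≥ 1`, contains a primitive `e`-th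
root of unity (a root of the `e`-th cyclotomic polynomial, which divides `T^e − 1`).
[cite: MochizukiGenEll2010, Thm 2.1 p.11] -/
theorem exists_isPrimitiveRoot [CharZero K] (he : 0 < e)
    [IsSplittingField K N ((X ^ e - 1) * ((X ^ e - C x) * (X ^ e - C (1 - x))))] :
    ∃ ζ : N, IsPrimitiveRoot ζ e := by
  haveI : CharZero N := charZero_of_injective_algebraMap (algebraMap K N).injective
  obtain ⟨h1, -, -⟩ := splits_factors N x he
  have hcyc : Splits (cyclotomic e N) :=
    h1.of_dvd (by rw [← C_1]; exact X_pow_sub_C_ne_zero he 1) (cyclotomic.dvd_X_pow_sub_one e N)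
  obtain ⟨ζ, hζ⟩ := hcyc.exists_eval_eq_zero (by
    rw [degree_cyclotomic]; exact_mod_cast (Nat.totient_pos.mpr he).ne')
  exact ⟨ζ, (isRoot_cyclotomic_iff_charZero he).mp hζ⟩

/-- A splitting field of `(T^e − 1)(T^e − x)(T^e − (1−x))`, `e ≥ 1`, contains `e`-th roots `u`, `w`
of `x` and `1 − x`. [cite: MochizukiGenEll2010, Thm 2.1 p.11] -/
theorem exists_pow_eq (he : 0 < e)
    [IsSplittingField K N ((X ^ e - 1) * ((X ^ e - C x) * (X ^ e - C (1 - x))))] :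
    (∃ u : N, u ^ e = algebraMap K N x) ∧ ∃ w : N, w ^ e = algebraMap K N (1 - x) := by
  obtain ⟨-, h2, h3⟩ := splits_factors N x he
  have hdeg : ∀ a : N, degree (X ^ e - C a) ≠ 0 := fun a => by
    rw [degree_X_pow_sub_C he]; exact_mod_cast he.ne'
  obtain ⟨u, hu⟩ := h2.exists_eval_eq_zero (hdeg _)
  obtain ⟨w, hw⟩ := h3.exists_eval_eq_zero (hdeg _)
  simp only [eval_sub, eval_pow, eval_X, eval_C, sub_eq_zero] at hu hw
  exact ⟨⟨u, hu⟩, ⟨w, hw⟩⟩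

/-- If `ζ` is a primitive `e`-th root of unity and `u^e = a ≠ 0`, every root of `T^e − a` is
`u · ζ^i`. [folklore] -/
private theorem root_eq_mul_pow {ζ u y a : N} (he : 0 < e) (hζ : IsPrimitiveRoot ζ e) (hu : u ^ e = a)
    (ha : a ≠ 0) (hy : y ^ e = a) : ∃ i : ℕ, y = u * ζ ^ i := by
  haveI := NeZero.of_pos he
  have hu0 : u ≠ 0 := by rintro rfl; exact ha (by rw [← hu, zero_pow he.ne'])
  have hq : (y / u) ^ e = 1 := by rw [div_pow, hy, hu, div_self ha]
  obtain ⟨i, -, hi⟩ := hζ.eq_pow_of_pow_eq_one hq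
  exact ⟨i, by rw [hi, mul_div_cancel₀ y hu0]⟩

/-- `N = K(ζ, u, w)`: a splitting field of `(T^e − 1)(T^e − x)(T^e − (1−x))` (`x ≠ 0, 1`) is generated
over `K` by a primitive `e`-th root of unity and one root of each of `T^e − x`, `T^e − (1 − x)`.
[cite: MochizukiGenEll2010, Thm 2.1 p.11] -/
theorem adjoin_eq_top_of_roots (he : 0 < e) (hx0 : x ≠ 0) (hx1 : x ≠ 1)
    [IsSplittingField K N ((X ^ e - 1) * ((X ^ e - C x) * (X ^ e - C (1 - x))))]
    {ζ u w : N} (hζ : IsPrimitiveRoot ζ e) (hu : u ^ e = algebraMap K N x)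
    (hw : w ^ e = algebraMap K N (1 - x)) :
    Algebra.adjoin K ({ζ, u, w} : Set N) = ⊤ := by
  have hx0' : algebraMap K N x ≠ 0 := (_root_.map_ne_zero _).mpr hx0
  have hx1' : algebraMap K N (1 - x) ≠ 0 :=
    (_root_.map_ne_zero _).mpr (sub_ne_zero.mpr (Ne.symm hx1))
  rw [eq_top_iff, ← IsSplittingField.adjoin_rootSet N
    ((X ^ e - 1) * ((X ^ e - C x) * (X ^ e - C (1 - x))) : K[X]), Algebra.adjoin_le_iff]
  intro y hy
  rw [mem_rootSet] at hy
  obtain ⟨-, hy⟩ := hy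
  simp only [map_mul, map_sub, map_pow, aeval_X, aeval_one, aeval_C, mul_eq_zero, sub_eq_zero] at hy
  have hζmem : ζ ∈ Algebra.adjoin K ({ζ, u, w} : Set N) := Algebra.subset_adjoin (by simp)
  have humem : u ∈ Algebra.adjoin K ({ζ, u, w} : Set N) := Algebra.subset_adjoin (by simp)
  have hwmem : w ∈ Algebra.adjoin K ({ζ, u, w} : Set N) := Algebra.subset_adjoin (by simp)
  rcases hy with hy | hy | hy
  · obtain ⟨i, rfl⟩ := root_eq_mul_pow N he hζ (one_pow e) one_ne_zero hy
    rw [one_mul]; exact Subalgebra.pow_mem _ hζmem i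
  · obtain ⟨i, rfl⟩ := root_eq_mul_pow N he hζ hu hx0' hy
    exact Subalgebra.mul_mem _ humem (Subalgebra.pow_mem _ hζmem i)
  · rw [← map_sub] at hy
    obtain ⟨i, rfl⟩ := root_eq_mul_pow N he hζ hw hx1' hy
    exact Subalgebra.mul_mem _ hwmem (Subalgebra.pow_mem _ hζmem i)

/-- A splitting field over a field of characteristic zero is a Galois extension. [folklore] -/
private theorem isGalois_of_isSplittingField' [CharZero K] (f : K[X]) [IsSplittingField K N f] :
    IsGalois K N := by
  haveI : Normal K N := Normal.of_isSplittingField f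
  haveI : FiniteDimensional K N := IsSplittingField.finiteDimensional N f
  rw [isGalois_iff]
  exact ⟨inferInstance, inferInstance⟩

end SplittingField

/-! ## The tower `K ⊆ K(ζ) ⊆ K(ζ, u) ⊆ N` and the different bound -/

section Tower

variable (P : NFPoint) (N : Type) [Field N] [NumberField N] [Algebra P.F N]

/-- The different bound along the explicit tower `K ⊆ K⟮ζ⟯ ⊆ K⟮ζ⟯⟮u⟯ ⊆ N` (intermediate fields of
`N`), for `N/K` Galois generated over `K⟮ζ⟯⟮u⟯` by `w`. [cite: MochizukiGenEll2010, Prop 1.7 (i) p.9] -/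
private theorem logdisc_le_of_tower [IsGalois P.F N] (hP : P.InU) {e : ℕ} (he : 0 < e)
    {ζ u w : N} (hζ : ζ ^ e = 1) (hu : u ^ e = algebraMap P.F N P.x)
    (hw : w ^ e = algebraMap P.F N (1 - P.x))
    (htop : Algebra.adjoin (↥(IntermediateField.adjoin (↥(IntermediateField.adjoin P.F ({ζ} : Set N)))
      ({u} : Set N))) ({w} : Set N) = ⊤) :
    (Module.finrank ℚ N : ℝ)⁻¹ * Real.log ((discr N).natAbs : ℝ) ≤
      P.logDiff + P.logCond + (Real.log e + Real.log (Module.finrank P.F N) +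
        Real.log (Module.finrank P.F N).factorial) := by
  haveI : IsScalarTower P.F (↥(IntermediateField.adjoin (↥(IntermediateField.adjoin P.F
      ({ζ} : Set N))) ({u} : Set N))) N := IsScalarTower.of_algebraMap_eq (fun _ => rfl)
  have hζint : IsIntegral P.F ζ := Algebra.IsIntegral.isIntegral ζ
  have huint : IsIntegral (↥(IntermediateField.adjoin P.F ({ζ} : Set N))) u :=
    Algebra.IsIntegral.isIntegral u
  refine logdisc_kummer_le P (↥(IntermediateField.adjoin P.F ({ζ} : Set N)))
    (↥(IntermediateField.adjoin (↥(IntermediateField.adjoin P.F ({ζ} : Set N))) ({u} : Set N))) N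
    hP he.ne' (ζ := AdjoinSimple.gen P.F ζ) ?_ (adjoin.powerBasis hζint).adjoin_gen_eq_top
    (u := AdjoinSimple.gen _ u) ?_ (adjoin.powerBasis huint).adjoin_gen_eq_top (w := w) hw htop
  · apply Subtype.ext
    simp [hζ]
  · apply Subtype.ext
    change u ^ e = ((algebraMap P.F _ P.x : ↥(IntermediateField.adjoin
      (↥(IntermediateField.adjoin P.F ({ζ} : Set N))) ({u} : Set N))) : N)
    rw [hu]
    exact IsScalarTower.algebraMap_apply P.F _ N P.x

/-- **[GenEll] Prop. 1.7 (i), right inequality, for the Kummer covering of `(ℙ¹, [0]+[1]+[∞])`.**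
For a point `x ∈ U(K)` of `ℙ¹ ∖ {0,1,∞}` presented over `K` and ANY splitting field `N` of
`(T^e − 1)(T^e − x)(T^e − (1 − x))` over `K` (the Galois closure of the Fermat covering
`u^e + w^e = 1 → λ = u^e` at `x`): `logdisc N ≤ log-diff(x) + log-cond_C(x) + log e + log [N:K] +
log [N:K]!`. [cite: MochizukiGenEll2010, Prop 1.7 (i) p.9] -/
theorem logdisc_le_of_isSplittingField_kummer (hP : P.InU) {e : ℕ} (he : 0 < e)
    [IsSplittingField P.F N ((X ^ e - 1) * ((X ^ e - C P.x) * (X ^ e - C (1 - P.x))))] :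
    (Module.finrank ℚ N : ℝ)⁻¹ * Real.log ((discr N).natAbs : ℝ) ≤
      P.logDiff + P.logCond + (Real.log e + Real.log (Module.finrank P.F N) +
        Real.log (Module.finrank P.F N).factorial) := by
  haveI : IsGalois P.F N :=
    isGalois_of_isSplittingField' N ((X ^ e - 1) * ((X ^ e - C P.x) * (X ^ e - C (1 - P.x))))
  obtain ⟨ζ, hζ⟩ := exists_isPrimitiveRoot N P.x he
  obtain ⟨⟨u, hu⟩, ⟨w, hw⟩⟩ := exists_pow_eq N P.x he
  have hgen := adjoin_eq_top_of_roots N P.x he hP.1 hP.2 hζ hu hw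
  refine logdisc_le_of_tower P N hP he hζ.pow_eq_one hu hw ?_
  -- `N = K(ζ, u, w)` ⇒ `K(ζ)(u)[w] = N`
  set K₂ := IntermediateField.adjoin (↥(IntermediateField.adjoin P.F ({ζ} : Set N))) ({u} : Set N)
    with hK₂
  haveI : IsScalarTower P.F (↥K₂) N := IsScalarTower.of_algebraMap_eq (fun _ => rfl)
  have hsub : ({ζ, u, w} : Set N) ⊆ (Algebra.adjoin (↥K₂) ({w} : Set N) : Set N) := by
    have hζ₂ : ζ ∈ (Algebra.adjoin (↥K₂) ({w} : Set N)) := by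
      have hmem : ζ ∈ K₂ := IntermediateField.algebraMap_mem K₂
        (AdjoinSimple.gen P.F ζ : ↥(IntermediateField.adjoin P.F ({ζ} : Set N)))
      exact Subalgebra.algebraMap_mem (Algebra.adjoin (↥K₂) ({w} : Set N)) (⟨ζ, hmem⟩ : ↥K₂)
    have hu₂ : u ∈ (Algebra.adjoin (↥K₂) ({w} : Set N)) :=
      Subalgebra.algebraMap_mem (Algebra.adjoin (↥K₂) ({w} : Set N))
        (⟨u, IntermediateField.mem_adjoin_simple_self _ u⟩ : ↥K₂)
    have hw₂ : w ∈ (Algebra.adjoin (↥K₂) ({w} : Set N)) := Algebra.subset_adjoin rfl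
    intro y hy
    rcases hy with rfl | rfl | rfl
    · exact hζ₂
    · exact hu₂
    · exact hw₂
  have hle : (⊤ : Subalgebra P.F N) ≤ (Algebra.adjoin (↥K₂) ({w} : Set N)).restrictScalars P.F := by
    rw [← hgen]; exact Algebra.adjoin_le hsub
  rw [eq_top_iff]
  intro y _
  exact hle Algebra.mem_top

/-- **Degree bound**: a splitting field of `(T^e − 1)(T^e − x)(T^e − (1 − x))` has degree `≤ e³`
over `K` (each of the three radical layers has degree `≤ e`) — the covering `Y → X` of the proof of
Thm. 2.1 has bounded degree (`d′ = d · deg(Y/X)`, p. 12). [cite: MochizukiGenEll2010, Thm 2.1 p.12] -/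
theorem finrank_le_of_isSplittingField_kummer (hP : P.InU) {e : ℕ} (he : 0 < e)
    [IsSplittingField P.F N ((X ^ e - 1) * ((X ^ e - C P.x) * (X ^ e - C (1 - P.x))))] :
    Module.finrank P.F N ≤ e ^ 3 := by
  obtain ⟨ζ, hζ⟩ := exists_isPrimitiveRoot N P.x he
  obtain ⟨⟨u, hu⟩, ⟨w, hw⟩⟩ := exists_pow_eq N P.x he
  have hgen := adjoin_eq_top_of_roots N P.x he hP.1 hP.2 hζ hu hw
  -- degree of a radical generator
  have hdeg : ∀ (F : Type) [Field F] [Algebra F N] (y : N) (a : F), y ^ e = algebraMap F N a →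
      (minpoly F y).natDegree ≤ e := by
    intro F _ _ y a hy
    have hy' : aeval y (X ^ e - C a : F[X]) = 0 := by simp [hy]
    have hne : (X ^ e - C a : F[X]) ≠ 0 := X_pow_sub_C_ne_zero he a
    calc (minpoly F y).natDegree ≤ (X ^ e - C a : F[X]).natDegree :=
          natDegree_le_of_dvd (minpoly.dvd F y hy') hne
      _ = e := natDegree_X_pow_sub_C
  set K₁ := IntermediateField.adjoin P.F ({ζ} : Set N) with hK₁
  set K₂ := IntermediateField.adjoin (↥K₁) ({u} : Set N) with hK₂
  haveI : IsScalarTower P.F (↥K₂) N := IsScalarTower.of_algebraMap_eq (fun _ => rfl)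
  have h1 : Module.finrank P.F ↥K₁ ≤ e := by
    rw [hK₁, adjoin.finrank (Algebra.IsIntegral.isIntegral ζ)]
    exact hdeg P.F ζ 1 (by rw [hζ.pow_eq_one, map_one])
  have h2 : Module.finrank ↥K₁ ↥K₂ ≤ e := by
    rw [hK₂, adjoin.finrank (Algebra.IsIntegral.isIntegral u)]
    exact hdeg ↥K₁ u (algebraMap P.F ↥K₁ P.x) (by rw [hu, ← IsScalarTower.algebraMap_apply])
  have h3 : Module.finrank ↥K₂ N ≤ e := by
    have hwint : IsIntegral ↥K₂ w := Algebra.IsIntegral.isIntegral w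
    -- `N = K(ζ, u, w)` as intermediate fields, hence `K₂⟮w⟯ = ⊤`
    have hIF : IntermediateField.adjoin P.F ({ζ, u, w} : Set N) = ⊤ := by
      apply IntermediateField.toSubalgebra_injective
      rw [IntermediateField.top_toSubalgebra]
      exact le_antisymm le_top (hgen ▸ IntermediateField.algebra_adjoin_le_adjoin P.F _)
    have h2top : IntermediateField.adjoin ↥K₂ ({ζ, u, w} : Set N) = ⊤ :=
      IntermediateField.adjoin_eq_top_of_adjoin_eq_top (F := P.F) hIF
    have hζK₂ : ζ ∈ K₂ := IntermediateField.algebraMap_mem K₂ (AdjoinSimple.gen P.F ζ : ↥K₁)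
    have huK₂ : u ∈ K₂ := IntermediateField.mem_adjoin_simple_self _ u
    have htop : IntermediateField.adjoin ↥K₂ ({w} : Set N) = ⊤ := by
      rw [eq_top_iff, ← h2top, IntermediateField.adjoin_le_iff]
      rintro y (rfl | rfl | rfl)
      · exact IntermediateField.algebraMap_mem _ (⟨y, hζK₂⟩ : ↥K₂)
      · exact IntermediateField.algebraMap_mem _ (⟨y, huK₂⟩ : ↥K₂)
      · exact IntermediateField.subset_adjoin _ _ rfl
    have hfin := adjoin.finrank hwint
    rw [htop, IntermediateField.finrank_top'] at hfin
    rw [hfin]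
    exact hdeg ↥K₂ w (algebraMap P.F ↥K₂ (1 - P.x)) (by rw [hw, ← IsScalarTower.algebraMap_apply])
  haveI : Module.Free ↥K₁ ↥K₂ := Module.Free.of_divisionRing ↥K₁ ↥K₂
  haveI : Module.Free ↥K₂ N := Module.Free.of_divisionRing ↥K₂ N
  haveI : Module.Free P.F ↥K₁ := Module.Free.of_divisionRing P.F ↥K₁
  haveI : Module.Free ↥K₁ N := Module.Free.of_divisionRing ↥K₁ N
  have hm1 : Module.finrank P.F ↥K₁ * Module.finrank ↥K₁ N = Module.finrank P.F N :=
    Module.finrank_mul_finrank P.F ↥K₁ N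
  have hm2 : Module.finrank ↥K₁ ↥K₂ * Module.finrank ↥K₂ N = Module.finrank ↥K₁ N :=
    Module.finrank_mul_finrank ↥K₁ ↥K₂ N
  calc Module.finrank P.F N = Module.finrank P.F ↥K₁ * Module.finrank ↥K₁ N := hm1.symm
    _ = Module.finrank P.F ↥K₁ * (Module.finrank ↥K₁ ↥K₂ * Module.finrank ↥K₂ N) := by rw [hm2]
    _ ≤ e * (e * e) := Nat.mul_le_mul h1 (Nat.mul_le_mul h2 h3)
    _ = e ^ 3 := by ring

end Tower

/-! ## The consumer form: the log-different of a Fermat point over `x` -/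

section Consumer

/-- **The different input of Step 1 of [GenEll] Thm. 2.1's proof for `ℙ¹`** ([GenEll] p. 12:
"we may apply Proposition 1.7, (i), to conclude that `log-diff_Y ≲ log-diff_X + log-cond_D` on
`U_Y(Q̄)`", for the Fermat covering `Y : u^e + w^e = 1 → ℙ¹`, `λ = u^e`): for points `x = P ∈ U(K)`
and `Q` presented over a field `K(u, w)` with `u^e = x`, `w^e = 1 − x`,
`log-diff(Q) ≤ log-diff(P) + log-cond_C(P) + (4·log e + log (e³)!)` — a constant depending only
on `e`, valid in every degree. [cite: MochizukiGenEll2010, Thm 2.1 p.12] -/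
theorem NFPoint.logDiff_le_of_kummer (P Q : NFPoint) (hP : P.InU) (ι : P.F →+* Q.F) {e : ℕ}
    (he : 0 < e) {u w : Q.F} (hu : u ^ e = ι P.x) (hw : w ^ e = ι (1 - P.x))
    (hgen : letI : Algebra P.F Q.F := ι.toAlgebra
      IntermediateField.adjoin P.F ({u, w} : Set Q.F) = ⊤) :
    Q.logDiff ≤ P.logDiff + P.logCond + (4 * Real.log e + Real.log (e ^ 3).factorial) := by
  letI : Algebra P.F Q.F := ι.toAlgebra
  set f : P.F[X] := (X ^ e - 1) * ((X ^ e - C P.x) * (X ^ e - C (1 - P.x))) with hf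
  let N : Type := f.SplittingField
  haveI : NumberField N := NumberField.of_module_finite P.F N
  -- embed `Q.F = K(u, w)` into the splitting field
  have hsplit := splits_factors N P.x he
  -- the minimal polynomial of a root `s` of `T^e − a` splits in `N` because `T^e − a` does
  have hmin : ∀ (s : Q.F) (a : P.F), s ^ e = ι a → (X ^ e - C (algebraMap P.F N a) : N[X]).Splits →
      ((minpoly P.F s).map (algebraMap P.F N)).Splits := by
    intro s a hs hsp
    have hy : aeval s (X ^ e - C a : P.F[X]) = 0 := by
      simp only [map_sub, aeval_X_pow, aeval_C, hs, sub_eq_zero]; rfl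
    have hdvd : (minpoly P.F s).map (algebraMap P.F N) ∣ (X ^ e - C a : P.F[X]).map (algebraMap P.F N) :=
      Polynomial.map_dvd _ (minpoly.dvd P.F s hy)
    rw [Polynomial.map_sub, Polynomial.map_pow, map_X, map_C] at hdvd
    exact hsp.of_dvd (X_pow_sub_C_ne_zero he _) hdvd
  have hK : ∀ s ∈ ({u, w} : Set Q.F), IsIntegral P.F s ∧
      ((minpoly P.F s).map (algebraMap P.F N)).Splits := by
    intro s hs
    refine ⟨Algebra.IsIntegral.isIntegral s, ?_⟩
    rcases hs with rfl | rfl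
    · exact hmin s P.x hu hsplit.2.1
    · exact hmin s (1 - P.x) hw hsplit.2.2
  obtain ⟨φ⟩ := IntermediateField.nonempty_algHom_of_adjoin_splits hK hgen
  letI : Algebra Q.F N := φ.toRingHom.toAlgebra
  have hmono := logdisc_le_logdisc Q.F N
  have hmain := logdisc_le_of_isSplittingField_kummer P N hP he
  have hn := finrank_le_of_isSplittingField_kummer P N hP he
  have hn1 : 1 ≤ Module.finrank P.F N := Module.finrank_pos
  rw [NFPoint.logDiff_eq_log_discr]
  have hlogn : Real.log (Module.finrank P.F N) ≤ 3 * Real.log e := by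
    have h : ((Module.finrank P.F N : ℕ) : ℝ) ≤ (e : ℝ) ^ 3 := by exact_mod_cast hn
    calc Real.log (Module.finrank P.F N) ≤ Real.log ((e : ℝ) ^ 3) :=
          Real.log_le_log (by exact_mod_cast hn1) h
      _ = 3 * Real.log e := by rw [Real.log_pow]; norm_num
  have hlogf : Real.log (Module.finrank P.F N).factorial ≤ Real.log (e ^ 3).factorial :=
    Real.log_le_log (by exact_mod_cast Nat.factorial_pos _)
      (by exact_mod_cast Nat.factorial_le hn)
  change (Q.degree : ℝ)⁻¹ * Real.log ((discr Q.F).natAbs : ℝ) ≤ _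
  have hdeg : (Q.degree : ℝ) = Module.finrank ℚ Q.F := rfl
  rw [hdeg]
  linarith

end Consumer

end Literature.NumberTheory.DiophantineGeometry.GenEll

end
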